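import Literature.AlgebraicGeometry.Motives.HodgeDecompositionIsInternalProofs
import Literature.NumberTheory.Transcendental.KaehlerIdentityLambdaProofs
import HarnessLib

/-!
# The Hodge decomposition `H^k_dR(M; ℂ) = ⨁_{p+q=k} K^{p,q}` from the Hodge theorem alone

Trunk **T-KAEHLER** (`AlgebraicGeometry/Motives`). Theorems-only sequel of
`HodgeDecompositionIsInternalProofs.lean`, about the named fact
`Literature.AlgebraicGeometry.Motives.isInternal_hodgePQ` of `HodgeDecomposition.lean` (**hodge.S07**,
the Hodge decomposition of a compact Kähler manifold; Voisin (2002), §6.1.3, p. 121 with Prop. 6.11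
(`K^{p,q}` = classes representable by a closed `(p,q)`-form, `H^{p,q} = K^{p,q}`) and Cor. 6.14).

`HodgeDecompositionIsInternalProofs.lean` reduces the fact to its two deep inputs
(`isInternal_hodgePQ_of_hodgeTheorem_of_kaehlerIdentity`): Warner's Theorem 6.11 (harmonic
representatives, the named fact `existsUnique_isHarmonicForm_mk_eq_of_compact`, hypothesis `h11`)
and the Kähler identity `Δ_d = 2Δ_∂̄` (Voisin's Thm. 6.7, the named fact
`cHodgeLaplacian_eq_two_smul_dolbeaultLaplacian_of_isManifold_complex g o`, hypothesis `hK`). The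
second input is now a theorem of the tree for Hausdorff complex manifolds —
`Literature.NumberTheory.Transcendental.cHodgeLaplacian_eq_two_smul_dolbeaultLaplacian_of_isManifold_complex_of_t2Space`
(`KaehlerIdentityLambdaProofs.lean`: Voisin's Prop. 6.5 by osculation, `KaehlerIdentityAssemblyProofs.lean`
and `KaehlerIdentityEdgeDegreeProofs.lean`, passed to `Λ`-form and fed to the algebra of
`KaehlerHodgeLaplacianDProofs.lean`) — and `isInternal_hodgePQ` binds `[T2Space M]` itself. Hence:

* `isInternal_hodgePQ_of_hodgeTheorem (h11) : isInternal_hodgePQ` — **the Hodge decomposition from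
  the Hodge theorem (Warner 6.11) alone**; the closed discharge `isInternal_hodgePQ_holds` is this
  theorem fed `existsUnique_isHarmonicForm_mk_eq_of_compact_holds` the moment that lands (it is
  Warner's elliptic Thms. 6.5/6.6, cf. `HodgeTheoremEllipticReductionProofs.lean`).

No named fact is introduced (D-0026).

## References

* C. Voisin, *Hodge Theory and Complex Algebraic Geometry I* (2002), §6.1.2 Thm. 6.7, §6.1.3
  Prop. 6.11, Cor. 6.14 (PDF p. 121). [Voisin2002]
* F. W. Warner, *Foundations of Differentiable Manifolds and Lie Groups*, GTM 94 (1983), Thm. 6.11.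
  [WarnerGTM94]
-/

noncomputable section

open scoped Manifold ContDiff Topology
open Bundle Module Set Finset

namespace Literature.AlgebraicGeometry.Motives

open Literature.Geometry.Kaehler Literature.NumberTheory.Transcendental

variable {E : Type*} [NormedAddCommGroup E] [NormedSpace ℂ E]
  {M : Type*} [TopologicalSpace M] [ChartedSpace E M] [FiniteDimensional ℂ E]
  [IsManifold 𝓘(ℝ, E) ∞ M]

/-- **hodge.S07, the Hodge decomposition `H^k_dR(M; ℂ) = ⨁_{p+q=k} K^{p,q}`, from the Hodge theorem
alone** (Voisin (2002), §6.1.3, p. 121 with Prop. 6.11 and Cor. 6.14). The named fact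
`isInternal_hodgePQ` follows from Warner's Theorem 6.11 — every real de Rham class of a compact
oriented Riemannian manifold has a unique harmonic representative — for every smooth metric on `M`
installed as the Riemannian bundle, every orientation family and all degrees (hypothesis `h11`, the
named fact `existsUnique_isHarmonicForm_mk_eq_of_compact` of `Motives/HodgeTheorem.lean`, exactly as in
`isInternal_hodgePQ_of_hodgeTheorem_of_kaehlerIdentity`); the Kähler identity `Δ_d = 2Δ_∂̄`
(Voisin, Thm. 6.7) that the latter also assumed is supplied by the theorem
`cHodgeLaplacian_eq_two_smul_dolbeaultLaplacian_of_isManifold_complex_of_t2Space`, the manifold of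
`isInternal_hodgePQ` being Hausdorff. [cite: Voisin2002, §6.1.3 Prop. 6.11] -/
theorem isInternal_hodgePQ_of_hodgeTheorem
    (h11 : ∀ [T2Space M] [CompactSpace M] {n : ℕ} [Fact (finrank ℝ E = n)]
      (g : ContMDiffRiemannianMetric 𝓘(ℝ, E) ∞ E (fun x : M ↦ TangentSpace 𝓘(ℝ, E) x))
      (o : (x : M) → Orientation ℝ (TangentSpace 𝓘(ℝ, E) x) (Fin n)) (k m : ℕ),
      letI : RiemannianBundle (fun x : M ↦ TangentSpace 𝓘(ℝ, E) x) := ⟨g.toRiemannianMetric⟩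
      haveI : IsContMDiffRiemannianBundle 𝓘(ℝ, E) ∞ E (fun x : M ↦ TangentSpace 𝓘(ℝ, E) x) :=
        ⟨g.inner, g.contMDiff, fun _ _ _ ↦ rfl⟩
      existsUnique_isHarmonicForm_mk_eq_of_compact 𝓘(ℝ, E) M o k m) :
    isInternal_hodgePQ (E := E) (M := M) := by
  intro _ _ _ _ k
  exact isInternal_hodgePQ_of_hodgeTheorem_of_kaehlerIdentity (E := E) (M := M) h11
    (fun g o ↦ cHodgeLaplacian_eq_two_smul_dolbeaultLaplacian_of_isManifold_complex_of_t2Space g o) k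

end Literature.AlgebraicGeometry.Motives
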